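import Mathlib
import Summits.NavierStokesRegularity.NavierStokesRegularity.Theorems.TaoLadderRungThreeGappedFrontRobustTailEnergy
import HarnessLib

/-!
# `GappedFrontRobust`, tools for the (step) clause: the ONE-DIRECTIONAL TAIL STEP (square-root /
  Bihari form of the tail energy cap; helper for item stmt-NavierStokesRegularity-20423, crux K_B of
  routes TaoLadderRungThree / TaoLadderRungTwo / TaoLadderRungTwoPoly and its announced restatement)

HONEST FRAMING: elementary real-analysis lemmas about Tao-type MODEL lattice pseudo-flows (Tao 2016, §4
(4.5), (4.9)–(4.10) with the cancellation (4.3)), in the cell vocabulary `TaoCascade.PseudoFlowOn` of the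
tree module `RestartedCascadeFlows`; continuation of `…GappedFrontRobustTailEnergy`. Nothing here is a
statement about the Navier–Stokes equations, and nothing is asserted about any table.

WHAT THIS IS FOR. By `pseudoFlowOn_tail_energy_le`, the energy of shell `K` (indeed of every block
above the bond `K-1 | K`) is at most the tail start energy `E₀` plus `∫ botSum(K-1)`, and
`|botSum(K-1)| ≤ (1+ε₀)^{5(K-1)/2} (∑|α_{·,(0,0,1)}|) P² · √(2 ∑_i F_{i,K})` when `|S_{i,K-1}| ≤ P`: an
integral inequality of the shape `y ≤ E₀ + ∫ g √y` for `y = ∑_i F_{i,K}`. The square-root (Bihari)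
lemma `sqrt_le_sqrt_add_half_integral` turns it into the explicit bound
`√(∑_i F_{i,K}(s)) ≤ √E₀ + (√2/2)(1+ε₀)^{5(K-1)/2} (∑|α_{·,(0,0,1)}|) ∫₀^s P²`
(`pseudoFlowOn_sqrt_shell_energy_le_tail`, amplitude form `pseudoFlowOn_abs_le_tail_step`): the
amplitude of shell `K` over the clock window is controlled by the start energy above it and the
time-integrated squared amplitude of the shell BELOW it only. Iterating shell by shell up the `TailFat`
zone needs no bootstrap over infinitely many shells; at the interface with the active zone it supplies
the bound on the first tail shell that the finite Grönwall comparison of the active shells consumes.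
Also here: `pseudoFlowOn_sq_le_tail` (amplitude form of the tail energy cap).
-/

noncomputable section

-- the sub-problem namespace `Summit.NavierStokesRegularity.NavierStokesRegularity` repeats the summit name by design (D-0017)
set_option linter.dupNamespace false

namespace Summit.NavierStokesRegularity.NavierStokesRegularity.Theorems

open Set MeasureTheory intervalIntegral Literature.Analysis.FluidPDE Literature.Analysis.FluidPDE.TaoCascade

namespace GappedFrontRobust

variable {m : ℕ}

/-! ### The square-root (Bihari) lemma -/

/-- **Square-root (Bihari) lemma.** If `y, g` are continuous and nonnegative on `[0, τ]`, `y₀ ≥ 0`, and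
`y(s) ≤ y₀ + ∫₀^s g(u) √(y(u)) du` for all `s ∈ [0, τ]`, then `√(y(s)) ≤ √y₀ + ½ ∫₀^s g` on `[0, τ]`.
(Compare `Y := y₀ + ε + ∫₀ g√y`, whose square root has derivative `g√y/(2√Y) ≤ g/2`, with the
boundary function `√(y₀+ε) + ½∫₀ g`; let `ε → 0`.) [folklore] -/
theorem sqrt_le_sqrt_add_half_integral {y g : ℝ → ℝ} {τ y₀ : ℝ}
    (hy : ContinuousOn y (Icc 0 τ)) (hg : ContinuousOn g (Icc 0 τ))
    (hg0 : ∀ s ∈ Icc 0 τ, 0 ≤ g s) (hy₀ : 0 ≤ y₀)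
    (hle : ∀ s ∈ Icc 0 τ, y s ≤ y₀ + ∫ u in (0 : ℝ)..s, g u * Real.sqrt (y u)) :
    ∀ s ∈ Icc 0 τ, Real.sqrt (y s) ≤ Real.sqrt y₀ + (1 / 2) * ∫ u in (0 : ℝ)..s, g u := by
  intro s hs
  have hτ : 0 ≤ τ := hs.1.trans hs.2
  -- clamp to `[0, τ]` and extend the data continuously to `ℝ`
  set c : ℝ → ℝ := fun u => max 0 (min u τ) with hc
  have hc_mem : ∀ u, c u ∈ Icc 0 τ := fun u => ⟨le_max_left _ _, max_le hτ (min_le_right _ _)⟩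
  have hc_id : ∀ u ∈ Icc 0 τ, c u = u := fun u hu => by
    simp only [hc, min_eq_left hu.2, max_eq_right hu.1]
  have hc_cont : Continuous c := continuous_const.max (continuous_id.min continuous_const)
  set gc : ℝ → ℝ := fun u => g (c u) with hgc
  set G : ℝ → ℝ := fun u => g (c u) * Real.sqrt (y (c u)) with hG
  have hgc_cont : Continuous gc := hg.comp_continuous hc_cont hc_mem
  have hyc_cont : Continuous fun u => y (c u) := hy.comp_continuous hc_cont hc_mem
  have hG_cont : Continuous G := hgc_cont.mul hyc_cont.sqrt
  have hgc0 : ∀ u, 0 ≤ gc u := fun u => hg0 _ (hc_mem u)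
  have hG0 : ∀ u, 0 ≤ G u := fun u => mul_nonneg (hgc0 u) (Real.sqrt_nonneg _)
  have hGint : ∀ x ∈ Icc 0 τ,
      ∫ u in (0 : ℝ)..x, G u = ∫ u in (0 : ℝ)..x, g u * Real.sqrt (y u) := by
    intro x hx
    refine intervalIntegral.integral_congr fun u hu => ?_
    rw [uIcc_of_le hx.1] at hu
    simp only [hG, hc_id u ⟨hu.1, hu.2.trans hx.2⟩]
  have hgcint : ∀ x ∈ Icc 0 τ, ∫ u in (0 : ℝ)..x, gc u = ∫ u in (0 : ℝ)..x, g u := by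
    intro x hx
    refine intervalIntegral.integral_congr fun u hu => ?_
    rw [uIcc_of_le hx.1] at hu
    simp only [hgc, hc_id u ⟨hu.1, hu.2.trans hx.2⟩]
  refine le_of_forall_pos_le_add fun δ hδ => ?_
  set ε : ℝ := δ ^ 2 with hε
  have hεpos : 0 < ε := by positivity
  -- the comparison function `Y` and its square root `f`
  set Y : ℝ → ℝ := fun x => y₀ + ε + ∫ u in (0 : ℝ)..x, G u with hY
  have hYderiv : ∀ x, HasDerivAt Y (G x) x := fun x =>
    (intervalIntegral.integral_hasDerivAt_right (hG_cont.intervalIntegrable 0 x)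
      (hG_cont.stronglyMeasurableAtFilter _ _) hG_cont.continuousAt).const_add (y₀ + ε)
  have hYge : ∀ x, 0 ≤ x → ε ≤ Y x := fun x hx => by
    have : 0 ≤ ∫ u in (0 : ℝ)..x, G u := intervalIntegral.integral_nonneg hx fun u _ => hG0 u
    simp only [hY]
    linarith
  set f : ℝ → ℝ := fun x => Real.sqrt (Y x) with hf
  have hfderiv : ∀ x, 0 ≤ x → HasDerivAt f (G x / (2 * Real.sqrt (Y x))) x := fun x hx =>
    (hYderiv x).sqrt (by linarith [hYge x hx])
  -- the boundary function `B`
  set B : ℝ → ℝ := fun x => Real.sqrt (y₀ + ε) + (1 / 2) * ∫ u in (0 : ℝ)..x, gc u with hB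
  have hBderiv : ∀ x, HasDerivAt B ((1 / 2) * gc x) x := fun x =>
    ((intervalIntegral.integral_hasDerivAt_right (hgc_cont.intervalIntegrable 0 x)
      (hgc_cont.stronglyMeasurableAtFilter _ _) hgc_cont.continuousAt).const_mul (1 / 2)).const_add _
  -- `y ≤ Y - ε` on `[0, τ]`
  have hyY : ∀ x ∈ Icc 0 τ, y x ≤ Y x - ε := fun x hx => by
    have := hle x hx
    simp only [hY, hGint x hx]
    linarith
  have key : ∀ ⦃x⦄, x ∈ Icc 0 τ → f x ≤ B x := by
    refine image_le_of_deriv_right_le_deriv_boundary (f' := fun x => G x / (2 * Real.sqrt (Y x)))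
      (B' := fun x => (1 / 2) * gc x) ?_ ?_ ?_ ?_ ?_ ?_
    · exact fun x hx => ((hfderiv x hx.1).continuousAt).continuousWithinAt
    · exact fun x hx => (hfderiv x hx.1).hasDerivWithinAt
    · simp only [hf, hB, hY, intervalIntegral.integral_same, add_zero, mul_zero, le_refl]
    · exact fun x _ => ((hBderiv x).continuousAt).continuousWithinAt
    · exact fun x _ => (hBderiv x).hasDerivWithinAt
    · intro x hx
      have hxI : x ∈ Icc 0 τ := ⟨hx.1, hx.2.le⟩
      have hYpos : 0 < Real.sqrt (Y x) := Real.sqrt_pos.mpr (by linarith [hYge x hx.1])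
      have hsq : Real.sqrt (y (c x)) ≤ Real.sqrt (Y x) := by
        rw [hc_id x hxI]
        exact Real.sqrt_le_sqrt (by linarith [hyY x hxI])
      have h1 : G x ≤ gc x * Real.sqrt (Y x) := mul_le_mul_of_nonneg_left hsq (hgc0 x)
      rw [div_le_iff₀ (by linarith)]
      nlinarith
  -- conclude
  have h1 : Real.sqrt (y s) ≤ f s := Real.sqrt_le_sqrt (by linarith [hyY s hs])
  have h2 : Real.sqrt (y₀ + ε) ≤ Real.sqrt y₀ + δ := by
    have h3 : y₀ + ε ≤ (Real.sqrt y₀ + δ) ^ 2 := by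
      nlinarith [Real.sq_sqrt hy₀, Real.sqrt_nonneg y₀, hδ.le]
    calc Real.sqrt (y₀ + ε) ≤ Real.sqrt ((Real.sqrt y₀ + δ) ^ 2) := Real.sqrt_le_sqrt h3
      _ = Real.sqrt y₀ + δ := Real.sqrt_sq (by positivity)
  have h4 : f s ≤ B s := key hs
  simp only [hB, hgcint s hs] at h4
  linarith

variable {τ ε₀ : ℝ} {α : Fin m → Fin m → Fin m → ℤ × ℤ × ℤ → ℝ} {κ₁ κ₂ : ℝ}
  {S₀ F₀ B₀ : Fin m → ℤ → ℝ} {S F : Fin m → ℤ → ℝ → ℝ}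

/-! ### Amplitude form of the tail energy cap -/

/-- **Amplitude form of the tail energy cap**: under the hypotheses of `pseudoFlowOn_tail_energy_le`,
`½ S_{i,k}(s)² ≤ E₀ + ∫₀^s botSum(K-1)` for every mode `i` and every shell `k ≥ K` ((4.10), lower
half). [cite: Tao2016AveragedNS, §4 Lemma 4.1 (4.5), (4.9)–(4.10) with (4.3)] -/
theorem pseudoFlowOn_sq_le_tail (h : PseudoFlowOn τ ε₀ α κ₁ κ₂ S₀ F₀ B₀ S F) (hτ : 0 < τ)
    (hε : 0 < ε₀) (hα : IsCancellingCoeff α) (K : ℤ) {E₀ : ℝ}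
    (hE₀ : ∀ L : ℕ, ∑ k ∈ Finset.range L, ∑ i, F₀ i (K + k) ≤ E₀)
    (i : Fin m) {k : ℤ} (hk : K ≤ k) {s : ℝ} (hs : s ∈ Icc 0 τ) :
    (1 / 2) * S i k s ^ 2 ≤ E₀ + ∫ u in (0 : ℝ)..s, botSum ε₀ α S (K - 1) u := by
  have h1 : F i k s ≤ ∑ j, F j k s :=
    Finset.single_le_sum (f := fun j => F j k s) (fun j _ => h.nonneg_F j k s hs) (Finset.mem_univ i)
  exact (h.defect_lower i k s hs).trans
    (h1.trans (pseudoFlowOn_shell_energy_le_tail h hτ hε hα K hE₀ hk hs))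

/-! ### The one-directional tail step -/

/-- **ONE-DIRECTIONAL TAIL STEP (square-root form).** Along a pseudo-flow on `[0, τ]` (`τ > 0`,
`ε₀ > 0`, cancelling table), let the partial sums of the start energies over the shells `k ≥ K` be
`≤ E₀` (`E₀ ≥ 0`) and let `P` be a continuous bound for the amplitudes of shell `K-1`:
`|S_{i,K-1}(u)| ≤ P(u)` on `[0, τ]`. Then for every `s ∈ [0, τ]`,
`√(∑_i F_{i,K}(s)) ≤ √E₀ + (√2/2) (1+ε₀)^{5(K-1)/2} (∑_{i₁,i₂,i₃}|α_{i,(0,0,1)}|) ∫₀^s P(u)² du`.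
[cite: Tao2016AveragedNS, §4 Lemma 4.1 (4.5), (4.9)–(4.10) with (4.3)] -/
theorem pseudoFlowOn_sqrt_shell_energy_le_tail (h : PseudoFlowOn τ ε₀ α κ₁ κ₂ S₀ F₀ B₀ S F)
    (hτ : 0 < τ) (hε : 0 < ε₀) (hα : IsCancellingCoeff α) (K : ℤ) {E₀ : ℝ} (hE₀0 : 0 ≤ E₀)
    (hE₀ : ∀ L : ℕ, ∑ k ∈ Finset.range L, ∑ i, F₀ i (K + k) ≤ E₀)
    {P : ℝ → ℝ} (hP : ContinuousOn P (Icc 0 τ))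
    (hSP : ∀ u ∈ Icc 0 τ, ∀ i, |S i (K - 1) u| ≤ P u) {s : ℝ} (hs : s ∈ Icc 0 τ) :
    Real.sqrt (∑ i, F i K s) ≤ Real.sqrt E₀ +
      Real.sqrt 2 / 2 * (1 + ε₀) ^ ((5 : ℝ) * (K - 1 : ℤ) / 2) *
        (∑ i₁, ∑ i₂, ∑ i₃, |α i₁ i₂ i₃ (0, 0, 1)|) * ∫ u in (0 : ℝ)..s, P u ^ 2 := by
  have hq : 0 < 1 + ε₀ := by linarith
  set Λ : ℝ := (1 + ε₀) ^ ((5 : ℝ) * (K - 1 : ℤ) / 2) with hΛ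
  have hΛ0 : 0 ≤ Λ := (Real.rpow_pos_of_pos hq _).le
  set C : ℝ := ∑ i₁ : Fin m, ∑ i₂ : Fin m, ∑ i₃ : Fin m, |α i₁ i₂ i₃ (0, 0, 1)| with hC
  have hC0 : 0 ≤ C := Finset.sum_nonneg fun _ _ => Finset.sum_nonneg fun _ _ =>
    Finset.sum_nonneg fun _ _ => abs_nonneg _
  have hS : ∀ i n, ContinuousOn (S i n) (Icc 0 τ) := fun i n => (h.contDiffOn_S i n).continuousOn
  have hFc : ∀ i n, ContinuousOn (F i n) (Icc 0 τ) := fun i n => (h.contDiffOn_F i n).continuousOn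
  -- the energy of shell K and the driving weight
  set y : ℝ → ℝ := fun u => ∑ i, F i K u with hy
  set g : ℝ → ℝ := fun u => Real.sqrt 2 * Λ * C * P u ^ 2 with hg
  have hy_cont : ContinuousOn y (Icc 0 τ) := continuousOn_finsetSum _ fun i _ => hFc i K
  have hg_cont : ContinuousOn g (Icc 0 τ) := continuousOn_const.mul (hP.pow 2)
  have hg0 : ∀ u ∈ Icc 0 τ, 0 ≤ g u := fun u _ => by positivity
  -- amplitudes of shell K by its energy
  have hQ : ∀ u ∈ Icc 0 τ, ∀ i, |S i K u| ≤ Real.sqrt (2 * y u) := by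
    intro u hu i
    have h1 : F i K u ≤ y u :=
      Finset.single_le_sum (f := fun j => F j K u) (fun j _ => h.nonneg_F j K u hu) (Finset.mem_univ i)
    exact Real.abs_le_sqrt (by linarith [h.defect_lower i K u hu])
  -- the integral inequality y ≤ E₀ + ∫ g √y
  have hle : ∀ x ∈ Icc 0 τ, y x ≤ E₀ + ∫ u in (0 : ℝ)..x, g u * Real.sqrt (y u) := by
    intro x hx
    have hsub : uIcc 0 x ⊆ Icc 0 τ := by
      rw [uIcc_of_le hx.1]
      exact Icc_subset_Icc_right hx.2
    have h1 : y x ≤ E₀ + ∫ u in (0 : ℝ)..x, botSum ε₀ α S (K - 1) u := by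
      have := pseudoFlowOn_shell_energy_le_tail h hτ hε hα K hE₀ (le_refl K) hx
      simpa only [hy] using this
    have hbint : IntervalIntegrable (fun u => botSum ε₀ α S (K - 1) u) volume 0 x :=
      ((continuousOn_botSum ε₀ α hS (K - 1)).mono hsub).intervalIntegrable
    have hgyint : IntervalIntegrable (fun u => g u * Real.sqrt (y u)) volume 0 x :=
      ((hg_cont.mul hy_cont.sqrt).mono hsub).intervalIntegrable
    have h2 : ∫ u in (0 : ℝ)..x, botSum ε₀ α S (K - 1) u ≤
        ∫ u in (0 : ℝ)..x, g u * Real.sqrt (y u) := by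
      refine intervalIntegral.integral_mono_on hx.1 hbint hgyint fun u hu => ?_
      have huτ : u ∈ Icc 0 τ := ⟨hu.1, hu.2.trans hx.2⟩
      have hb := abs_botSum_le_of_abs_le ε₀ hq α S (K - 1) u (hSP u huτ) (fun i => by
        rw [sub_add_cancel]
        exact hQ u huτ i)
      have hsq : Real.sqrt (2 * y u) = Real.sqrt 2 * Real.sqrt (y u) :=
        Real.sqrt_mul (by norm_num) _
      calc botSum ε₀ α S (K - 1) u ≤ |botSum ε₀ α S (K - 1) u| := le_abs_self _
        _ ≤ Λ * P u ^ 2 * Real.sqrt (2 * y u) * C := hb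
        _ = g u * Real.sqrt (y u) := by rw [hsq, hg]; ring
    linarith
  have := sqrt_le_sqrt_add_half_integral hy_cont hg_cont hg0 hE₀0 hle s hs
  -- unfold g and pull the constant out of the integral
  have hconst : ∫ u in (0 : ℝ)..s, g u = Real.sqrt 2 * Λ * C * ∫ u in (0 : ℝ)..s, P u ^ 2 := by
    simp only [hg, intervalIntegral.integral_const_mul]
  rw [hconst] at this
  calc Real.sqrt (∑ i, F i K s) = Real.sqrt (y s) := rfl
    _ ≤ Real.sqrt E₀ + 1 / 2 * (Real.sqrt 2 * Λ * C * ∫ u in (0 : ℝ)..s, P u ^ 2) := this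
    _ = Real.sqrt E₀ + Real.sqrt 2 / 2 * Λ * C * ∫ u in (0 : ℝ)..s, P u ^ 2 := by ring

/-- **ONE-DIRECTIONAL TAIL STEP (amplitude form).** Under the hypotheses of
`pseudoFlowOn_sqrt_shell_energy_le_tail`, every amplitude of shell `K` obeys
`|S_{i,K}(s)| ≤ √2 (√E₀ + (√2/2)(1+ε₀)^{5(K-1)/2} (∑|α_{·,(0,0,1)}|) ∫₀^s P²)` on `[0, τ]` — a continuous
bound of the same shape as `P`, ready to be fed to the next shell.
[cite: Tao2016AveragedNS, §4 Lemma 4.1 (4.5), (4.9)–(4.10) with (4.3)] -/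
theorem pseudoFlowOn_abs_le_tail_step (h : PseudoFlowOn τ ε₀ α κ₁ κ₂ S₀ F₀ B₀ S F)
    (hτ : 0 < τ) (hε : 0 < ε₀) (hα : IsCancellingCoeff α) (K : ℤ) {E₀ : ℝ} (hE₀0 : 0 ≤ E₀)
    (hE₀ : ∀ L : ℕ, ∑ k ∈ Finset.range L, ∑ i, F₀ i (K + k) ≤ E₀)
    {P : ℝ → ℝ} (hP : ContinuousOn P (Icc 0 τ))
    (hSP : ∀ u ∈ Icc 0 τ, ∀ i, |S i (K - 1) u| ≤ P u) (i : Fin m) {s : ℝ} (hs : s ∈ Icc 0 τ) :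
    |S i K s| ≤ Real.sqrt 2 * (Real.sqrt E₀ +
      Real.sqrt 2 / 2 * (1 + ε₀) ^ ((5 : ℝ) * (K - 1 : ℤ) / 2) *
        (∑ i₁, ∑ i₂, ∑ i₃, |α i₁ i₂ i₃ (0, 0, 1)|) * ∫ u in (0 : ℝ)..s, P u ^ 2) := by
  have h1 : F i K s ≤ ∑ j, F j K s :=
    Finset.single_le_sum (f := fun j => F j K s) (fun j _ => h.nonneg_F j K s hs) (Finset.mem_univ i)
  have h2 : |S i K s| ≤ Real.sqrt (2 * ∑ j, F j K s) :=
    Real.abs_le_sqrt (by linarith [h.defect_lower i K s hs])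
  rw [Real.sqrt_mul (by norm_num)] at h2
  exact h2.trans (mul_le_mul_of_nonneg_left
    (pseudoFlowOn_sqrt_shell_energy_le_tail h hτ hε hα K hE₀0 hE₀ hP hSP hs) (Real.sqrt_nonneg 2))

/-! ### The tail induction (appended by p1 g9: iterate the one-directional step up the tail) -/

/-- **TAIL INDUCTION.** Along a pseudo-flow on `[0, τ]` (`τ > 0`, `ε₀ > 0`, cancelling table), let
`k₂` be a shell, `E K ≥ 0` bounds for all partial sums of the start energies above every `K ≥ k₂`,
and `P : ℤ → ℝ` candidate amplitude bounds satisfying the RECURSION CONDITION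
`√2 · (√(E K) + (√2/2) (1+ε₀)^{5(K-1)/2} (∑|α_{·,(0,0,1)}|) τ P(K-1)²) ≤ P K` for `K ≥ k₂`. If the
amplitudes of the base shell obey `|S_{i,k₂-1}(u)| ≤ P(k₂-1)` on `[0, τ]`, then EVERY shell `K ≥ k₂ - 1`
obeys `|S_{i,K}(u)| ≤ P K` on `[0, τ]` (induction on `K` with `pseudoFlowOn_abs_le_tail_step`; no
bootstrap over the infinitely many tail shells is needed — the prover of a robust step only has to
exhibit real numbers `E`, `P` meeting the recursion from the tail clauses of the certificate).
[cite: Tao2016AveragedNS, §4 Lemma 4.1 (4.5), (4.9)–(4.10) with (4.3)] -/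
theorem pseudoFlowOn_tail_induction (h : PseudoFlowOn τ ε₀ α κ₁ κ₂ S₀ F₀ B₀ S F)
    (hτ : 0 < τ) (hε : 0 < ε₀) (hα : IsCancellingCoeff α) (k₂ : ℤ) {E P : ℤ → ℝ}
    (hE0 : ∀ K : ℤ, k₂ ≤ K → 0 ≤ E K)
    (hE : ∀ K : ℤ, k₂ ≤ K → ∀ L : ℕ, ∑ k ∈ Finset.range L, ∑ i, F₀ i (K + k) ≤ E K)
    (hrec : ∀ K : ℤ, k₂ ≤ K →
      Real.sqrt 2 * (Real.sqrt (E K) + Real.sqrt 2 / 2 * (1 + ε₀) ^ ((5 : ℝ) * (K - 1 : ℤ) / 2) *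
        (∑ i₁, ∑ i₂, ∑ i₃, |α i₁ i₂ i₃ (0, 0, 1)|) * (τ * P (K - 1) ^ 2)) ≤ P K)
    (hbase : ∀ u ∈ Icc 0 τ, ∀ i, |S i (k₂ - 1) u| ≤ P (k₂ - 1)) :
    ∀ K : ℤ, k₂ - 1 ≤ K → ∀ u ∈ Icc 0 τ, ∀ i, |S i K u| ≤ P K := by
  have hq : 0 < 1 + ε₀ := by linarith
  -- induction on the number of shells above the base
  have key : ∀ n : ℕ, ∀ u ∈ Icc 0 τ, ∀ i, |S i (k₂ - 1 + n) u| ≤ P (k₂ - 1 + n) := by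
    intro n
    induction n with
    | zero => simpa using hbase
    | succ n ih =>
      intro u hu i
      have hK : k₂ ≤ k₂ - 1 + (n + 1 : ℕ) := by push_cast; linarith
      set K : ℤ := k₂ - 1 + (n + 1 : ℕ) with hKdef
      have hKm : K - 1 = k₂ - 1 + n := by rw [hKdef]; push_cast; ring
      -- the previous shell's constant bound, as a continuous function
      have hP : ContinuousOn (fun _ : ℝ => P (K - 1)) (Icc 0 τ) := continuousOn_const
      have hSP : ∀ v ∈ Icc 0 τ, ∀ j, |S j (K - 1) v| ≤ (fun _ : ℝ => P (K - 1)) v := by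
        intro v hv j
        simp only [hKm]
        exact ih v hv j
      have hstep := pseudoFlowOn_abs_le_tail_step h hτ hε hα K (hE0 K hK) (hE K hK) hP hSP i hu
      have hC0 : 0 ≤ ∑ i₁ : Fin m, ∑ i₂ : Fin m, ∑ i₃ : Fin m, |α i₁ i₂ i₃ (0, 0, 1)| :=
        Finset.sum_nonneg fun _ _ => Finset.sum_nonneg fun _ _ => Finset.sum_nonneg fun _ _ =>
          abs_nonneg _
      have hΛ0 : 0 ≤ (1 + ε₀) ^ ((5 : ℝ) * (K - 1 : ℤ) / 2) := (Real.rpow_pos_of_pos hq _).le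
      -- ∫₀ᵘ P² = P² u ≤ P² τ
      have hint : ∫ v in (0 : ℝ)..u, (fun _ : ℝ => P (K - 1)) v ^ 2 ≤ τ * P (K - 1) ^ 2 := by
        simp only [intervalIntegral.integral_const, sub_zero, smul_eq_mul]
        nlinarith [hu.1, hu.2, sq_nonneg (P (K - 1))]
      have hmono : Real.sqrt 2 * (Real.sqrt (E K) +
          Real.sqrt 2 / 2 * (1 + ε₀) ^ ((5 : ℝ) * (K - 1 : ℤ) / 2) *
            (∑ i₁, ∑ i₂, ∑ i₃, |α i₁ i₂ i₃ (0, 0, 1)|) *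
              ∫ v in (0 : ℝ)..u, (fun _ : ℝ => P (K - 1)) v ^ 2) ≤
          Real.sqrt 2 * (Real.sqrt (E K) +
            Real.sqrt 2 / 2 * (1 + ε₀) ^ ((5 : ℝ) * (K - 1 : ℤ) / 2) *
              (∑ i₁, ∑ i₂, ∑ i₃, |α i₁ i₂ i₃ (0, 0, 1)|) * (τ * P (K - 1) ^ 2)) := by
        have hc : 0 ≤ Real.sqrt 2 / 2 * (1 + ε₀) ^ ((5 : ℝ) * (K - 1 : ℤ) / 2) *
            (∑ i₁ : Fin m, ∑ i₂ : Fin m, ∑ i₃ : Fin m, |α i₁ i₂ i₃ (0, 0, 1)|) := by positivity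
        exact mul_le_mul_of_nonneg_left (by nlinarith [mul_le_mul_of_nonneg_left hint hc])
          (Real.sqrt_nonneg 2)
      exact (hstep.trans hmono).trans (hrec K hK)
  intro K hK u hu i
  obtain ⟨n, hn⟩ := Int.eq_ofNat_of_zero_le (show 0 ≤ K - (k₂ - 1) by linarith)
  have hK' : K = k₂ - 1 + (n : ℤ) := by linarith
  rw [hK']
  exact key n u hu i

end GappedFrontRobust

end Summit.NavierStokesRegularity.NavierStokesRegularity.Theorems

end
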